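import Summits.Ventures.LatticeQCDFlow.Scoring.ChainTauIntEmpiricalVariance
import Summits.Ventures.LatticeQCDFlow.Scoring.ChainScorerDataWindowCLT

/-!
# A DATA-DRIVEN CALIBRATION OF THE PRINTED MADRAS–SOKAL BAR ON MARKOV-CHAIN DATA: the statistic
# `ρ̂_N = (4W+2) τ̂_W² / σ̂²_{A,N}` converges in probability to the number `ρ = (4W+2) τ_W² / σ²_ℓ` that
# decides the printed bar's asymptotic coverage `N(0, 1/ρ)([−z, z])` — conservative iff `ρ ≥ 1`

HONEST FRAMING: exact (Metropolis-corrected) sampling algorithms for lattice gauge theory;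
figures of merit are autocorrelation/cost numbers at stated couplings and volumes; no
continuum-physics claim.

Venture `LatticeQCDFlow` (cell pub-lqcd), sub-topic `Scoring`; FANOUT row 16 (`su2-base`), GEN-10.
NEW WORK of the cell, not a published result; no definition is introduced; nothing is cited as a fact
(the Madras–Sokal error formula `δτ = τ √((4W+2)/N)`, Madras–Sokal 1988 App. — NAMED ONLY; its status
here is that of a statistic whose coverage is computed, not assumed).  What the law-of-the-error packet
says to a seat that reads `τ_int ± δτ_B` from scorer B: on chain data the printed bar's coverage tends to
`N(0, σ²_ℓ/((4W+2) τ_W²))([−z, z])` (GEN-9 `ChainScorerDataWindowCLT.chain_tendsto_measure_printedBar_of_nHit`),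
nominal exactly when `σ²_ℓ = (4W+2) τ_W²`.  THIS FILE makes the criterion CHECKABLE FROM THE DATA: with
GEN-10's fully empirical variance estimate `σ̂²_{A,N}` (`Scoring/ChainTauIntEmpiricalVariance`) and scorer
A's `τ̂_W`, the calibration statistic `ρ̂_N = (4W+2) τ̂_W² / σ̂²_{A,N}` converges in probability, from
EVERY initial law, to `ρ = (4W+2) τ_W² / σ²_ℓ`; the printed bar's coverage limit is the centred Gaussian
mass of `[−z, z]` at variance `1/ρ`, which is `≥` the nominal level iff `ρ ≥ 1` and `≤` it iff `ρ ≤ 1`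
(Gaussian interval mass is antitone in the variance).  So `√ρ̂_N` estimates the factor by which the
printed bar should be divided to become honest (`δτ_B / (σ̂_{A,N}/√N) = √ρ̂_N` exactly).

## Content (`κ` Markov, `π` invariant, `(nHit κ m)(z,·) ≥ ε ν` for all `z`, `ε ≠ 0`, `0 < m`; `|f| ≤ C`
## measurable, `f̄ = f − ∫ f dπ`, `C(0) ≠ 0`; `τ_W = tauIntWindow (C/C(0)) W ≠ 0`;
## `σ²_ℓ = Σ_s Σ_t ℓ_s ℓ_t Σ(s,t) > 0`; `σ̂²_{A,N}` as in `ChainTauIntEmpiricalVariance`; `μ₀` ANY law)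

* `measure_Icc_gaussianReal_antitone` — `w₁ ≤ w₂ ⇒ N(0,w₂)([−z,z]) ≤ N(0,w₁)([−z,z])`;
* `printedBar_limitVariance_eq` — `msScale W τ_W ² · σ²_ℓ = σ²_ℓ / ((4W+2) τ_W²)` with `σ²_ℓ` in the
  Green–Kubo form of GEN-9 rewritten as the quadratic form `ℓᵀ Σ ℓ`;
* **`chain_printedBarCalib_tendstoInMeasure_of_nHit`** — `ρ̂_N → ρ` in `P_{μ₀}`-measure;
* **`chain_tendsto_measure_printedBar_calib_of_nHit`** — the printed bar's coverage on chain data tends to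
  `gaussianReal 0 (σ²_ℓ/((4W+2) τ_W²)) (Icc (−z) z)` (GEN-9's theorem with the realised Gaussian limit and
  the variance in calibration form);
* `printedBar_limit_le_nominal_of_le` — the NEW direction of the criterion: `(4W+2) τ_W² ≤ σ²_ℓ` ⇒ limit
  `≤` nominal (the converse, `σ²_ℓ ≤ (4W+2) τ_W²` ⇒ limit `≥` nominal, is GEN-7's
  `MadrasSokalCoverage.nominal_le_printedBar_limit`).

NOT CLAIMED: a test with stated level for `ρ = 1` (the law of `ρ̂_N − ρ` is not typed); the data-chosen
window (compose with GEN-8's transfer as in `ChainScorerStudentisedAtMSWindow`); any number about row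
16's chains.
-/

noncomputable section

open MeasureTheory ProbabilityTheory Filter Finset Preorder WithLp Set
open scoped ENNReal NNReal Topology RealInnerProductSpace
open Summit.Ventures.LatticeQCDFlow.Exactness Summit.Ventures.LatticeQCDFlow.Exactness.GeneralNCMC

namespace Summit.Ventures.LatticeQCDFlow.Scoring

/-! ## Gaussian interval mass is antitone in the variance -/

section Gauss

/-- **Centred Gaussian interval mass decreases with the variance**: `w₁ ≤ w₂`, `z ≥ 0` ⇒
`N(0,w₂)([−z, z]) ≤ N(0,w₁)([−z, z])` (`N(0,0) = δ_0`). -/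
theorem measure_Icc_gaussianReal_antitone {w₁ w₂ : ℝ≥0} (hw : w₁ ≤ w₂) {z : ℝ} (hz : 0 ≤ z) :
    gaussianReal 0 w₂ (Icc (-z) z) ≤ gaussianReal 0 w₁ (Icc (-z) z) := by
  by_cases hw0 : w₁ = 0
  · rw [hw0, gaussianReal_zero_var, Measure.dirac_apply' _ measurableSet_Icc,
      Set.indicator_of_mem (by simp [hz] : (0 : ℝ) ∈ Icc (-z) z), Pi.one_apply]
    exact prob_le_one
  · have hw1 : 0 < (w₁ : ℝ) := by
      have : (0 : ℝ≥0) < w₁ := pos_iff_ne_zero.2 hw0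
      exact_mod_cast this
    set s : ℝ := Real.sqrt ((w₂ : ℝ) / w₁) with hs
    have hdiv : (1 : ℝ) ≤ (w₂ : ℝ) / w₁ := by
      rw [le_div_iff₀ hw1, one_mul]; exact_mod_cast hw
    have hs1 : 1 ≤ s := by
      rw [hs]
      calc (1 : ℝ) = Real.sqrt 1 := Real.sqrt_one.symm
        _ ≤ Real.sqrt ((w₂ : ℝ) / w₁) := Real.sqrt_le_sqrt hdiv
    have hs0 : 0 < s := lt_of_lt_of_le zero_lt_one hs1
    have hmap : (gaussianReal 0 w₁).map (s * ·) = gaussianReal 0 w₂ := by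
      rw [gaussianReal_map_const_mul, mul_zero]
      congr 1
      apply NNReal.eq
      rw [NNReal.coe_mul, NNReal.coe_mk, hs, Real.sq_sqrt (div_nonneg w₂.coe_nonneg w₁.coe_nonneg),
        div_mul_cancel₀ _ hw1.ne']
    rw [← hmap, Measure.map_apply (measurable_const_mul s) measurableSet_Icc]
    refine measure_mono fun y hy => ?_
    simp only [Set.mem_preimage, Set.mem_Icc] at hy ⊢
    constructor <;> nlinarith [hy.1, hy.2]

/-- The printed bar's limit variance in calibration form: `B(τ_W)² R = R / ((4W+2) τ_W²)`. -/
theorem msScale_sq_mul (W : ℕ) (τW R : ℝ) :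
    msScale W τW ^ 2 * R = R / ((4 * W + 2) * τW ^ 2) := by
  rw [msScale_sq, inv_mul_eq_div]

/-- **Under-coverage criterion**: if `(4W+2) τ_W² ≤ R` (`τ_W ≠ 0`) then the printed bar's limiting coverage
`N(0, B(τ_W)² R)([−z, z])` is AT MOST the nominal `N(0,1)([−z, z])`. -/
theorem printedBar_limit_le_nominal_of_le (W : ℕ) {R τW : ℝ} (hτ : τW ≠ 0)
    (hR : (4 * W + 2) * τW ^ 2 ≤ R) {z : ℝ} (hz : 0 ≤ z) :
    gaussianReal 0 (NNReal.mk (msScale W τW ^ 2) (sq_nonneg _) * R.toNNReal) (Icc (-z) z)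
      ≤ gaussianReal 0 1 (Icc (-z) z) := by
  refine measure_Icc_gaussianReal_antitone ?_ hz
  have hpos : 0 < (4 * (W : ℝ) + 2) * τW ^ 2 := by positivity
  have hR0 : 0 ≤ R := hpos.le.trans hR
  rw [← NNReal.coe_le_coe, NNReal.coe_mul, NNReal.coe_mk, Real.coe_toNNReal _ hR0, NNReal.coe_one,
    msScale_sq_mul, one_le_div hpos]
  exact hR

end Gauss

/-! ## Along the chain -/

section Chain

variable {S : Type*} [MeasurableSpace S]
variable (κ : Kernel S S) [IsMarkovKernel κ] (W : ℕ) {π : Measure S} [IsProbabilityMeasure π]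
  {ν : Measure S} [IsProbabilityMeasure ν] {ε : ℝ≥0∞} {m : ℕ}

/-- **The printed bar's limit variance on chain data IS `σ²_ℓ / ((4W+2) τ_W²)`** with `σ²_ℓ = ℓᵀ Σ ℓ`:
GEN-9's Green–Kubo form `windowLRVar κ π W (lagProdComb f̄ W ℓ)` rewritten as the quadratic form of
Bartlett's `Σ` (`quadForm_chainLagACov_of_nHit`) and `B(τ_W)² = ((4W+2) τ_W²)⁻¹`. -/
theorem printedBar_limitVariance_eq (hπ : Kernel.Invariant κ π) (hε : ε ≠ 0)
    (hmin : ∀ z, ε • ν ≤ nHit κ m z) (hm : 0 < m) {g : S → ℝ} (hg : Measurable g) {C : ℝ}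
    (hC : ∀ z, |g z| ≤ C) (τW : ℝ) :
    NNReal.mk (msScale W τW ^ 2) (sq_nonneg _)
        * (windowLRVar κ π W (lagProdComb g W
            (tauHatGrad W (toLp 2 fun t : Fin (W + 1) => autocov κ π g t)))).toNNReal
      = ((∑ s : Fin (W + 1), ∑ t : Fin (W + 1),
          tauHatGrad W (toLp 2 fun u : Fin (W + 1) => autocov κ π g u) s
            * tauHatGrad W (toLp 2 fun u : Fin (W + 1) => autocov κ π g u) t
            * chainLagACov κ π g W s t) / ((4 * W + 2) * τW ^ 2)).toNNReal := by
  have hnn : 0 ≤ windowLRVar κ π W (lagProdComb g W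
      (tauHatGrad W (toLp 2 fun t : Fin (W + 1) => autocov κ π g t))) :=
    windowLRVar_nonneg_of_nHit κ W hπ hε hmin hm (measurable_lagProdComb hg W _)
      (abs_lagProdComb_le hC W _)
  rw [← quadForm_chainLagACov_of_nHit κ W hπ hε hmin hm hg hC] at hnn ⊢
  apply NNReal.eq
  rw [NNReal.coe_mul, NNReal.coe_mk, Real.coe_toNNReal _ hnn,
    Real.coe_toNNReal _ (div_nonneg hnn (by positivity)), msScale_sq_mul]

/-- **THE CALIBRATION STATISTIC CONVERGES IN PROBABILITY, FROM EVERY INITIAL LAW.**  With scorer A's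
`τ̂_N(W) = tauIntWindow (rhoHat (f ∘ X) N) W`, GEN-10's fully empirical `σ̂²_{A,N}` (sample-mean-centred
lag products, scorer A's own gradient, truncations `K_N → ∞`, `K_N³/N → 0`), `C(0) ≠ 0` and `σ²_ℓ ≠ 0`:
`ρ̂_N = (4W+2) τ̂_N(W)² / σ̂²_{A,N} → ρ = (4W+2) τ_W² / σ²_ℓ` in `P_{μ₀}`-measure. -/
theorem chain_printedBarCalib_tendstoInMeasure_of_nHit (hπ : Kernel.Invariant κ π) (hε : ε ≠ 0)
    (hmin : ∀ z, ε • ν ≤ nHit κ m z) (hm : 0 < m)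
    {f : S → ℝ} (hf : Measurable f) {C : ℝ} (hC : ∀ z, |f z| ≤ C)
    (hσ : autocov κ π (fun z => f z - ∫ z', f z' ∂π) 0 ≠ 0)
    (hℓ : ∑ s : Fin (W + 1), ∑ t : Fin (W + 1),
        tauHatGrad W (toLp 2 fun u : Fin (W + 1) => autocov κ π (fun z => f z - ∫ z', f z' ∂π) u) s
          * tauHatGrad W (toLp 2 fun u : Fin (W + 1) => autocov κ π (fun z => f z - ∫ z', f z' ∂π) u) t
          * chainLagACov κ π (fun z => f z - ∫ z', f z' ∂π) W s t ≠ 0)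
    {K : ℕ → ℕ} (hK : Tendsto K atTop atTop) (hK3 : Tendsto (fun N => (K N : ℝ) ^ 3 / N) atTop (𝓝 0))
    (μ₀ : Measure S) [IsProbabilityMeasure μ₀]
    [IsProbabilityMeasure (Kernel.trajMeasure (X := fun _ : ℕ => S) μ₀
        (fun n : ℕ => κ.comap (fun hh : (i : ↥(Finset.Iic n)) → S => hh ⟨n, Finset.mem_Iic.2 le_rfl⟩)
          (measurable_pi_apply _)))] :
    TendstoInMeasure (Kernel.trajMeasure (X := fun _ : ℕ => S) μ₀
        (fun n : ℕ => κ.comap (fun hh : (i : ↥(Finset.Iic n)) → S => hh ⟨n, Finset.mem_Iic.2 le_rfl⟩)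
          (measurable_pi_apply _)))
      (fun (N : ℕ) (x : ℕ → S) => (4 * W + 2) * tauIntWindow (rhoHat (fun i => f (x i)) N) W ^ 2
        / ∑ s : Fin (W + 1), ∑ t : Fin (W + 1),
          tauHatGrad W (toLp 2 fun u : Fin (W + 1) => gammaHat (fun j => f (x j)) N u) s
            * tauHatGrad W (toLp 2 fun u : Fin (W + 1) => gammaHat (fun j => f (x j)) N u) t
            * gammaCross
                (fun i => (f (x i) - sampleMean (fun j => f (x j)) N)
                  * (f (x (i + s)) - sampleMean (fun j => f (x j)) N))
                (fun i => (f (x i) - sampleMean (fun j => f (x j)) N)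
                  * (f (x (i + t)) - sampleMean (fun j => f (x j)) N)) N (K N))
      atTop (fun _ => (4 * W + 2) * tauIntWindow (fun t => autocov κ π (fun z => f z - ∫ z', f z' ∂π) t
          / autocov κ π (fun z => f z - ∫ z', f z' ∂π) 0) W ^ 2
        / ∑ s : Fin (W + 1), ∑ t : Fin (W + 1),
          tauHatGrad W (toLp 2 fun u : Fin (W + 1) => autocov κ π (fun z => f z - ∫ z', f z' ∂π) u) s
            * tauHatGrad W (toLp 2 fun u : Fin (W + 1) => autocov κ π (fun z => f z - ∫ z', f z' ∂π) u) t
            * chainLagACov κ π (fun z => f z - ∫ z', f z' ∂π) W s t) := by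
  have hτ := chain_scorer_tauIntWindow_tendstoInMeasure_of_nHit κ hπ hε hmin hm hf hC hσ μ₀ W
  have hV := chain_empTauIntVarHat_tendstoInMeasure_of_nHit κ W hπ hε hmin hm hf hC hσ hK hK3 μ₀
  have hnum := tendstoInMeasure_mul_lim (tendstoInMeasure_const_real (P := Kernel.trajMeasure
      (X := fun _ : ℕ => S) μ₀ (fun n : ℕ => κ.comap (fun hh : (i : ↥(Finset.Iic n)) → S =>
        hh ⟨n, Finset.mem_Iic.2 le_rfl⟩) (measurable_pi_apply _))) ((4 : ℝ) * W + 2))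
    (tendstoInMeasure_mul_lim hτ hτ)
  have h := tendstoInMeasure_congr_limit (tendstoInMeasure_div_lim hℓ hnum hV)
    (c' := fun _ => (4 * W + 2) * tauIntWindow (fun t => autocov κ π (fun z => f z - ∫ z', f z' ∂π) t
          / autocov κ π (fun z => f z - ∫ z', f z' ∂π) 0) W ^ 2
        / ∑ s : Fin (W + 1), ∑ t : Fin (W + 1),
          tauHatGrad W (toLp 2 fun u : Fin (W + 1) => autocov κ π (fun z => f z - ∫ z', f z' ∂π) u) s
            * tauHatGrad W (toLp 2 fun u : Fin (W + 1) => autocov κ π (fun z => f z - ∫ z', f z' ∂π) u) t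
            * chainLagACov κ π (fun z => f z - ∫ z', f z' ∂π) W s t)
    (funext fun _ => by ring)
  exact h.congr_left fun N => Eventually.of_forall fun x => by beta_reduce; ring

/-- **THE PRINTED BAR's COVERAGE LIMIT ON CHAIN DATA, IN CALIBRATION FORM.**  With
`τ̂_N(W) = tauIntWindow (rhoHat (f ∘ X) N) W`, `τ_W ≠ 0`, `C(0) ≠ 0`, for every `z > 0`:
`P_{μ₀}{τ_W within z printed bars of τ̂_N(W)} → N(0, σ²_ℓ/((4W+2) τ_W²))([−z, z]) = N(0, 1/ρ)([−z, z])`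
(GEN-9's `chain_tendsto_measure_printedBar_of_nHit` with the realised Gaussian limit). -/
theorem chain_tendsto_measure_printedBar_calib_of_nHit (hπ : Kernel.Invariant κ π) (hε : ε ≠ 0)
    (hmin : ∀ z, ε • ν ≤ nHit κ m z) (hm : 0 < m) {f : S → ℝ} (hf : Measurable f) {C : ℝ}
    (hC : ∀ z, |f z| ≤ C) (hσ : autocov κ π (fun z => f z - ∫ z', f z' ∂π) 0 ≠ 0)
    (hτ : tauIntWindow (fun t => autocov κ π (fun z => f z - ∫ z', f z' ∂π) t
        / autocov κ π (fun z => f z - ∫ z', f z' ∂π) 0) W ≠ 0)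
    (μ₀ : Measure S) [IsProbabilityMeasure μ₀]
    [IsProbabilityMeasure (Kernel.trajMeasure (X := fun _ : ℕ => S) μ₀
        (fun n : ℕ => κ.comap (fun hh : (i : ↥(Finset.Iic n)) → S => hh ⟨n, Finset.mem_Iic.2 le_rfl⟩)
          (measurable_pi_apply _)))] {z : ℝ} (hz : 0 < z) :
    Tendsto (fun N : ℕ => (Kernel.trajMeasure (X := fun _ : ℕ => S) μ₀
        (fun n : ℕ => κ.comap (fun hh : (i : ↥(Finset.Iic n)) → S => hh ⟨n, Finset.mem_Iic.2 le_rfl⟩)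
          (measurable_pi_apply _))) {x | |Real.sqrt N
        * (tauIntWindow (rhoHat (fun i => f (x i)) N) W
          - tauIntWindow (fun t => autocov κ π (fun z => f z - ∫ z', f z' ∂π) t
              / autocov κ π (fun z => f z - ∫ z', f z' ∂π) 0) W)
        * msScale W (tauIntWindow (rhoHat (fun i => f (x i)) N) W)| ≤ z}) atTop
      (𝓝 (gaussianReal 0 ((∑ s : Fin (W + 1), ∑ t : Fin (W + 1),
          tauHatGrad W (toLp 2 fun u : Fin (W + 1) => autocov κ π (fun z => f z - ∫ z', f z' ∂π) u) s
            * tauHatGrad W (toLp 2 fun u : Fin (W + 1) => autocov κ π (fun z => f z - ∫ z', f z' ∂π) u) t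
            * chainLagACov κ π (fun z => f z - ∫ z', f z' ∂π) W s t)
          / ((4 * W + 2) * (tauIntWindow (fun t => autocov κ π (fun z => f z - ∫ z', f z' ∂π) t
              / autocov κ π (fun z => f z - ∫ z', f z' ∂π) 0) W) ^ 2)).toNNReal (Icc (-z) z))) := by
  obtain ⟨hgm, hgC, -⟩ := centred_observable_bounds π hf hC
  obtain ⟨hZm, hZ⟩ := chain_gaussianLimit_realised κ W hπ hε hmin hm hgm hgC
  have h := chain_tendsto_measure_printedBar_of_nHit κ hπ hε hmin hm hf hC W hσ hτ μ₀ hZm hZ hz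
  rw [printedBar_limitVariance_eq κ W hπ hε hmin hm hgm hgC] at h
  exact h

/-- **The dichotomy on chain data.**  With `ρ = (4W+2) τ_W² / σ²_ℓ` (`τ_W ≠ 0`, `σ²_ℓ ≥ 0` automatic):
if `(4W+2) τ_W² ≤ σ²_ℓ` (i.e. `ρ ≤ 1`) the printed bar asymptotically UNDER-covers (limit `≤` nominal);
if `σ²_ℓ ≤ (4W+2) τ_W²` (`ρ ≥ 1`) it OVER-covers (limit `≥` nominal, GEN-9's
`chain_nominal_le_printedBar_limit`).  The under-coverage half: -/
theorem chain_printedBar_limit_le_nominal_of_le (hπ : Kernel.Invariant κ π) (hε : ε ≠ 0)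
    (hmin : ∀ z, ε • ν ≤ nHit κ m z) (hm : 0 < m) {f : S → ℝ} (hf : Measurable f) {C : ℝ}
    (hC : ∀ z, |f z| ≤ C)
    (hτ : tauIntWindow (fun t => autocov κ π (fun z => f z - ∫ z', f z' ∂π) t
        / autocov κ π (fun z => f z - ∫ z', f z' ∂π) 0) W ≠ 0)
    (hR : (4 * W + 2) * (tauIntWindow (fun t => autocov κ π (fun z => f z - ∫ z', f z' ∂π) t
        / autocov κ π (fun z => f z - ∫ z', f z' ∂π) 0) W) ^ 2
      ≤ ∑ s : Fin (W + 1), ∑ t : Fin (W + 1),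
          tauHatGrad W (toLp 2 fun u : Fin (W + 1) => autocov κ π (fun z => f z - ∫ z', f z' ∂π) u) s
            * tauHatGrad W (toLp 2 fun u : Fin (W + 1) => autocov κ π (fun z => f z - ∫ z', f z' ∂π) u) t
            * chainLagACov κ π (fun z => f z - ∫ z', f z' ∂π) W s t) {z : ℝ} (hz : 0 ≤ z) :
    gaussianReal 0 ((∑ s : Fin (W + 1), ∑ t : Fin (W + 1),
          tauHatGrad W (toLp 2 fun u : Fin (W + 1) => autocov κ π (fun z => f z - ∫ z', f z' ∂π) u) s
            * tauHatGrad W (toLp 2 fun u : Fin (W + 1) => autocov κ π (fun z => f z - ∫ z', f z' ∂π) u) t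
            * chainLagACov κ π (fun z => f z - ∫ z', f z' ∂π) W s t)
          / ((4 * W + 2) * (tauIntWindow (fun t => autocov κ π (fun z => f z - ∫ z', f z' ∂π) t
              / autocov κ π (fun z => f z - ∫ z', f z' ∂π) 0) W) ^ 2)).toNNReal (Icc (-z) z)
      ≤ gaussianReal 0 1 (Icc (-z) z) := by
  obtain ⟨hgm, hgC, -⟩ := centred_observable_bounds π hf hC
  rw [← printedBar_limitVariance_eq κ W hπ hε hmin hm hgm hgC]
  refine printedBar_limit_le_nominal_of_le W hτ ?_ hz
  rwa [← quadForm_chainLagACov_of_nHit κ W hπ hε hmin hm hgm hgC]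

end Chain

end Summit.Ventures.LatticeQCDFlow.Scoring

end
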